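import Mathlib.LinearAlgebra.Trace
import Mathlib.LinearAlgebra.Matrix.ToLin
import Literature.Algebra.Lie.RadicalKillingOrthogonal
import HarnessLib

/-!
# The trace of a finite kernel operator, and the trace of an operator through a subspace containing its image
# (linear algebra for the character of an induced representation: «`tr π(f) = ∫_K K_f(k,k) dk`»)

Topic `LinearAlgebra`; namespace `Literature.LinearAlgebra`.  THEOREMS ONLY (no definition, no instance, no notation, no named fact, no `sorry`).  Cell
`pub/hodgecm-mathlib`, line «CMCharIdentityTest» — brick VD-1 of the `stub_vanDijkGL` road (census `B-provers/B-p18/g31/CENSUS-VD-vanDijkGL-road.B-p18g31.md`):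
the two pieces of finite-dimensional linear algebra under van Dijk's computation of the character of `Ind_P^G τ` [vanDijk1972; BernsteinZelevinsky1977 §2.3]
— the operator `π(f)` on the `K′`-fixed vectors is (the restriction of) an integral operator on the finite set `K ⧸ K′`, whose trace is the diagonal sum of its
kernel.
* §1 **`LinearMap.trace_restrict_eq_trace_of_range_le`** — if `im T ⊆ W` then `tr_W (T|_W) = tr_V T` (the quotient map `T mod W` is `0`; ★
  `Literature.Algebra.Lie.trace_eq_trace_restrict_add_trace_mapQ`); and the form `trace_comp_subtype_eq_trace` for an operator FACTORING through `W`
  (`T = ι_W ∘ S`, `S : V → W`): `tr_W (S ∘ ι_W) = tr_V (ι_W ∘ S)` (Mathlib `LinearMap.trace_comp_comm'`).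
* §2 **`trace_kernelOp_eq_sum_diag`** — for a finite type `X` and a kernel `A : X → X → R`, the operator `φ ↦ (x ↦ Σ_y A x y · φ y)` on `X → R` is
  `Matrix.toLin' (Matrix.of A)` and has trace `Σ_x A x x` (Mathlib `Matrix.trace_toLin'_eq`); **`trace_restrict_kernelOp_eq_sum_diag`** — if it maps
  `X → R` into a subspace `W`, its restriction to `W` has trace `Σ_x A x x`.
HONEST LABEL: HC_CM is proved only modulo the printed citations (2 remaining named inputs hLiu418, h413) until rung 0 closes; this file is linear algebra.

## References
* [vanDijk1972] G. van Dijk, *Computation of certain induced characters of 𝔭-adic groups*, Math. Ann. 199 (1972), 229–240.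
* [BernsteinZelevinsky1977] I. N. Bernstein, A. V. Zelevinsky, *Induced representations of reductive 𝔭-adic groups I*, §2.3.
* [Bourbaki1989LieGroups13] N. Bourbaki, *Lie Groups and Lie Algebras*, Ch. I §4 no. 3 (trace in an adapted basis).
-/

set_option autoImplicit false

namespace Literature.LinearAlgebra

/-! ## §1 Trace through a subspace containing the image -/

section Restrict

variable {K : Type*} [Field K] {V : Type*} [AddCommGroup V] [Module K V] [FiniteDimensional K V]

/-- **`im T ⊆ W ⇒ tr (T|_W) = tr T`**: in a basis adapted to `W` the matrix of `T` is `[[A, B], [0, 0]]`; formally `tr T = tr T|_W + tr (T mod W)` (★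
`trace_eq_trace_restrict_add_trace_mapQ`) and `T mod W = 0`. [cite: Bourbaki1989LieGroups13, Ch. I §4 no. 3 Prop. 4 (d)] -/
theorem LinearMap.trace_restrict_eq_trace_of_range_le (T : V →ₗ[K] V) (W : Submodule K V) (hT : LinearMap.range T ≤ W) :
    LinearMap.trace K W (T.restrict (p := W) (q := W) fun x _ => hT (LinearMap.mem_range_self T x)) = LinearMap.trace K V T := by
  have hW : W ≤ W.comap T := fun x _ => hT (LinearMap.mem_range_self T x)
  have hq : W.mapQ W T hW = 0 := by
    refine LinearMap.ext fun x => ?_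
    induction x using Submodule.Quotient.induction_on with
    | H v =>
      rw [Submodule.mapQ_apply, LinearMap.zero_apply, Submodule.Quotient.mk_eq_zero]
      exact hT (LinearMap.mem_range_self T v)
  rw [Literature.Algebra.Lie.trace_eq_trace_restrict_add_trace_mapQ T W hW, hq, map_zero, add_zero]

/-- **An operator factoring through `W`**: for `S : V →ₗ W`, `tr_W (S ∘ ι_W) = tr_V (ι_W ∘ S)` (`ι_W` the inclusion) — the trace of the «restriction» of the
ambient operator `ι_W ∘ S` (whose image lies in `W`) is the ambient trace. [cite: Bourbaki1989LieGroups13, Ch. I §4 no. 3 Prop. 4 (d)] -/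
theorem LinearMap.trace_comp_subtype_eq_trace (W : Submodule K V) (S : V →ₗ[K] W) :
    LinearMap.trace K W (S ∘ₗ W.subtype) = LinearMap.trace K V (W.subtype ∘ₗ S) :=
  (LinearMap.trace_comp_comm' S W.subtype).symm

end Restrict

/-! ## §2 Kernel operators on a finite set -/

section Kernel

variable {R : Type*} [CommRing R] {X : Type*} [Fintype X] [DecidableEq X]

/-- The kernel operator `φ ↦ (x ↦ Σ_y A x y · φ y)` IS `Matrix.toLin' (Matrix.of A)`. [cite: BernsteinZelevinsky1977, §2.3] -/
theorem toLin'_of_apply (A : X → X → R) (φ : X → R) (x : X) :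
    Matrix.toLin' (Matrix.of A) φ x = ∑ y, A x y * φ y := by
  rw [Matrix.toLin'_apply, Matrix.mulVec, dotProduct]
  rfl

/-- **The trace of a finite kernel operator is the diagonal sum of its kernel**: `tr (φ ↦ Σ_y A(·,y) φ(y)) = Σ_x A x x`.
[cite: BernsteinZelevinsky1977, §2.3] [cite: Bourbaki1989LieGroups13, Ch. I §4 no. 3 Prop. 4 (d)] -/
theorem trace_kernelOp_eq_sum_diag (A : X → X → R) :
    LinearMap.trace R (X → R) (Matrix.toLin' (Matrix.of A)) = ∑ x, A x x := by
  rw [Matrix.trace_toLin'_eq, Matrix.trace]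
  rfl

variable {K : Type*} [Field K] {Y : Type*} [Fintype Y] [DecidableEq Y]

/-- **Kernel operator with image in a subspace**: if `φ ↦ Σ_y A(·,y)φ(y)` maps `Y → K` into `W`, the trace of its restriction to `W` is `Σ_x A x x` — the
shape of van Dijk's «`tr π(f) = ∫_K K_f(k,k) dk`» on the finite set `K ⧸ K′` (the kernel operator lands in the `P ∩ K`-equivariant functions and restricts
to `π(f)` there). [cite: vanDijk1972, Thm. p. 237] [cite: BernsteinZelevinsky1977, §2.3] -/
theorem trace_restrict_kernelOp_eq_sum_diag (A : Y → Y → K) (W : Submodule K (Y → K))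
    (hA : LinearMap.range (Matrix.toLin' (Matrix.of A)) ≤ W) :
    LinearMap.trace K W ((Matrix.toLin' (Matrix.of A)).restrict (p := W) (q := W) fun x _ => hA (LinearMap.mem_range_self _ x)) =
      ∑ x, A x x := by
  rw [LinearMap.trace_restrict_eq_trace_of_range_le, trace_kernelOp_eq_sum_diag]

/-- The same for ANY operator `T` on `W` that agrees with the kernel operator on `W` (the way `levelActOp` is given: an endomorphism of the fixed vectors
whose values are computed by the ambient formula). [cite: vanDijk1972, Thm. p. 237] [cite: BernsteinZelevinsky1977, §2.3] -/
theorem trace_eq_sum_diag_of_eq_kernelOp (A : Y → Y → K) (W : Submodule K (Y → K))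
    (hA : LinearMap.range (Matrix.toLin' (Matrix.of A)) ≤ W) (T : W →ₗ[K] W)
    (hT : ∀ w : W, ((T w : W) : Y → K) = Matrix.toLin' (Matrix.of A) (w : Y → K)) :
    LinearMap.trace K W T = ∑ x, A x x := by
  rw [← trace_restrict_kernelOp_eq_sum_diag A W hA]
  congr 1
  refine LinearMap.ext fun w => Subtype.ext ?_
  rw [hT w, LinearMap.coe_restrict_apply]

end Kernel

end Literature.LinearAlgebra
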